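import Literature.Barriers.ResolutionOfSingularities.RisoBlindAlongInseparableOrbitRtd
import HarnessLib

/-!
# Barrier «RisoBlindAlongInseparableOrbit» — `rtd = 0` along the whole orbit closure `Γ̄₂` (torus transport)

Third file of the kernel upgrade of barrier #4 of the LADDER-RESOLUTION cell `res-hironaka` (D-0021 / D-0089), after
`RisoBlindAlongInseparableOrbitRtd.lean` (headlines `…_rtdP`, `…_rtdBoth`: the riso-triviality dimension of the arc balls of
the W-Q fourfold `X₂ = V(fW)` at `P = (0,0,1,1,0)` and at the origin is `0`). Here the statement is moved along the purely
inseparable torus orbit: for EVERY integral parameter `μ` (`v(μ) ≤ 1`), at `Γ₂(μ) = (0,0,μ⁵,μ⁶,0)`, no non-zero `κ`-subspace is a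
riso-triviality direction of `X₂(K) ∩ B_{Γ₂(μ)}` and `rtd = 0` (Monreal Def. 3.17, `Riso.rtd`;
`Monreal2026_risoBlindAlongInseparableOrbit_rtdGamma2`) — for every perfect field `K` of characteristic `2`, every non-trivial
valuation, every coefficient field `κ`. This turns the barrier's «by the torus, `rtd ≡ 0` on `Γ₂∖0`» (cell report §9.4, last
sentence) into a kernel statement and, with `…_rtdBoth`, makes both clauses of its `blocks:` line statements about typed
definitions: the lowest rtd-cut of `Sing X₂` contains `0` and the whole cuspidal curve `Γ̄₂ = {x=y=v=0, w⁵=z⁶}`.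

## Mechanism (§1–§2) and proof
* A coordinatewise scaling by UNITS `D(a)_i = d_i a_i`, `v(d_i) = 1`, preserves the valuative size and the rv-RELATION of pairs
  (`rv(Dδ) = rv(Dδ') ⟺ rv(δ) = rv(δ')`, `rvEq_mul_of_units_iff`) — it is NOT itself a risometry (it rescales directions), but it
  CONJUGATES straighteners: if `φ'` straightens `X₂(K) ∩ B_{DP}` with translations `𝔪·w'`, then `D⁻¹ ∘ φ' ∘ D` straightens
  `X₂(K) ∩ B_P` with translations `𝔪·D⁻¹w'` (`wq_no_translation_invariant_straightening_torus`), contradicting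
  `wq_no_translation_invariant_straightening`.
* The torus of `fW` (weights `(99,18,20,24,29)`, `fW(λ·a) = λ¹⁹⁸ fW(a)`, `eval_fW_torus`; cf. `WQWitness.torus_fW`) with a unit
  `λ` is such a scaling, `X₂(K)` is stable, and `λ·P = (0,0,λ²⁰,λ²⁴,0) = Γ₂(λ⁴)`.
* In a PERFECT field of characteristic `2` every unit `μ` is `λ⁴` with `v(λ) = 1` (`exists_fourth_root`), so every `Γ₂(μ)` with
  `v(μ) = 1` is reached (`wq_rtd_gamma2_unit_eq_zero`); for `μ ∈ 𝔪` the point `Γ₂(μ)` is based at the origin and its radius-1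
  ball IS `B_0` (`isRisoTrivialOn_congr_centre`), where `…_rtdBoth` applies (`wq_rtd_gamma2_eq_zero`).

HONEST FRAMING: theorems about Monreal's DEFINITIONS 3.15/3.17 (typed in `Literature/AlgebraicGeometry/Resolution/
RisoTriviality.lean`) for the cell's own specimen; no theorem of [Monreal2026] is used or asserted; nothing here bears on the
characteristic-0 theory, on Question 1.6 in general, on resolution of singularities in characteristic `p`, or on
H. Hironaka's 2017 manuscript (under adjudication, D-0012 — not cited by any declaration). AI formalisation.
-/

noncomputable section

namespace Literature.Barriers.ResolutionOfSingularities

namespace RisoBlind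

open MvPolynomial Finset
open Literature.AlgebraicGeometry.Resolution Literature.AlgebraicGeometry.Resolution.Riso
open Literature.AlgebraicGeometry.Hironaka2017 Literature.AlgebraicGeometry.Hironaka2017.WQWitness
open Literature.AlgebraicGeometry.Hironaka2017.WQRiso

variable {K : Type*} [Field K] {Γ₀ : Type*} [LinearOrderedCommGroupWithZero Γ₀] (v : Valuation K Γ₀)

/-! ## §1 Coordinatewise scalings by units preserve valuative sizes and the rv-RELATION -/

/-- A coordinatewise scaling by units preserves the valuative size. [folklore] -/
private theorem vnorm_mul_of_units {n : ℕ} {d : Fin n → K} (hd : ∀ i, v (d i) = 1) (a : Fin n → K) :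
    vnorm v (fun i => d i * a i) = vnorm v a := by
  unfold vnorm
  exact Finset.sup_congr rfl fun i _ => by rw [map_mul, hd i, one_mul]

/-- A coordinatewise scaling by units preserves the rv-RELATION between two vectors (though not the rv-class of a single
vector: directions are rescaled). [folklore] -/
private theorem rvEq_mul_of_units_iff {n : ℕ} {d : Fin n → K} (hd : ∀ i, v (d i) = 1) (δ δ' : Fin n → K) :
    RvEq v (fun i => d i * δ i) (fun i => d i * δ' i) ↔ RvEq v δ δ' := by
  have hd0 : ∀ i, d i ≠ 0 := fun i => (Valuation.ne_zero_iff v).1 (by rw [hd i]; exact one_ne_zero)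
  have hsub : (fun i => d i * δ i) - (fun i => d i * δ' i) = fun i => d i * (δ - δ') i := by
    funext i; simp [mul_sub]
  unfold RvEq
  rw [hsub, vnorm_mul_of_units v hd, vnorm_mul_of_units v hd]
  constructor
  · rintro (h | h)
    · left; funext i; exact mul_left_cancel₀ (hd0 i) (congrFun h i)
    · exact Or.inr h
  · rintro (h | h)
    · left; rw [h]
    · exact Or.inr h

/-! ## §2 The torus of `fW` on field elements -/

/-- The torus `λ·(x,y,z,w,v) = (λ⁹⁹x, λ¹⁸y, λ²⁰z, λ²⁴w, λ²⁹v)` scales `fW` by `λ¹⁹⁸` (quasi-homogeneity; `WQWitness.torus_fW`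
at the level of field elements). [folklore] -/
private theorem eval_fW_torus (lam : K) (a : Fin 5 → K) :
    eval (fun i => (![lam ^ 99, lam ^ 18, lam ^ 20, lam ^ 24, lam ^ 29] : Fin 5 → K) i * a i)
        (fW : MvPolynomial (Fin 5) K) = lam ^ 198 * eval a (fW : MvPolynomial (Fin 5) K) := by
  simp [fW]; ring

/-- Balls of radius `1` (arcs with a given base point) around congruent centres coincide. [folklore] -/
private theorem ball_one_eq_of_vnorm_sub_lt {n : ℕ} {c c' : Fin n → K} (h : vnorm v (c - c') < 1) :
    ball v c 1 = ball v c' 1 := by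
  ext a
  simp only [mem_ball_iff]
  constructor
  · intro ha
    have : a - c' = (a - c) + (c - c') := by abel
    rw [this]; exact lt_of_le_of_lt (vnorm_add_le v _ _) (max_lt ha h)
  · intro ha
    have : a - c = (a - c') - (c - c') := by abel
    rw [this]; exact lt_of_le_of_lt (vnorm_sub_le v _ _) (max_lt ha h)

/-- Riso-triviality on a radius-`1` ball only depends on the ball: congruent centres give the same notion. [folklore] -/
private theorem isRisoTrivialOn_congr_centre {n : ℕ} {c c' : Fin n → K} (h : vnorm v (c - c') < 1)
    (κ : Type*) [Field κ] [Algebra κ K] (A : Set (Fin n → K)) (W : Submodule κ (Fin n → κ)) :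
    IsRisoTrivialOn v κ A c 1 W ↔ IsRisoTrivialOn v κ A c' 1 W := by
  unfold IsRisoTrivialOn IsTranslationInvariantOn
  rw [ball_one_eq_of_vnorm_sub_lt v h]

section CharTwo

variable [CharP K 2] [PerfectRing K 2]

/-- **No primitive riso-triviality direction at the torus translates of `P`.** For a unit `λ` (`v(λ) = 1`) and the point
`P_λ = λ·P = (0,0,λ²⁰,λ²⁴,0) = Γ₂(λ⁴)`: there is no risometry of `X₂(K) ∩ B_{P_λ}` onto a set invariant under `𝔪·w`, `‖w‖ = 1`.
Transport to `P` by conjugating with the torus scaling `D_λ` (a coordinatewise scaling by units preserves the rv-RELATION of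
pairs, `X₂` is `D_λ`-stable, `D_λ(B_P) = B_{P_λ}`), then `wq_no_translation_invariant_straightening`. (derived here)
[cite: Monreal2026, Def. 3.15 and Def. 3.17] -/
theorem wq_no_translation_invariant_straightening_torus (hK : ∃ t : K, 0 < v t ∧ v t < 1) {lam : K} (hlam : v lam = 1)
    {w : Fin 5 → K} (hw : vnorm v w = 1) {φ : (Fin 5 → K) → (Fin 5 → K)} {C : Set (Fin 5 → K)}
    (hφ : IsRisometry v ({a | eval a (fW : MvPolynomial (Fin 5) K) = 0} ∩ ball v ![0, 0, lam ^ 20, lam ^ 24, 0] 1) C φ)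
    (hT : ∀ c ∈ C, ∀ s : K, v s < 1 → c + s • w ∈ C) : False := by
  have hlam0 : lam ≠ 0 := (Valuation.ne_zero_iff v).1 (by rw [hlam]; exact one_ne_zero)
  -- the scaling and its inverse
  set d : Fin 5 → K := ![lam ^ 99, lam ^ 18, lam ^ 20, lam ^ 24, lam ^ 29] with hd
  set e : Fin 5 → K := fun i => (d i)⁻¹ with he
  have hdv : ∀ i, v (d i) = 1 := by
    intro i; rw [hd]; fin_cases i <;> simp [hlam]
  have hd0 : ∀ i, d i ≠ 0 := fun i => (Valuation.ne_zero_iff v).1 (by rw [hdv i]; exact one_ne_zero)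
  have hev : ∀ i, v (e i) = 1 := fun i => by rw [he, map_inv₀, hdv i, inv_one]
  set D : (Fin 5 → K) → (Fin 5 → K) := fun a i => d i * a i with hD
  set E : (Fin 5 → K) → (Fin 5 → K) := fun a i => e i * a i with hE
  have hED : ∀ a, E (D a) = a := fun a => by funext i; simp [hD, hE, he, inv_mul_cancel_left₀ (hd0 i)]
  have hDE : ∀ a, D (E a) = a := fun a => by funext i; simp [hD, hE, he, mul_inv_cancel_left₀ (hd0 i)]
  have hDP : D ![0, 0, 1, 1, 0] = ![0, 0, lam ^ 20, lam ^ 24, 0] := by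
    funext i; rw [hD, hd]; fin_cases i <;> simp
  have hDsub : ∀ a b, D a - D b = D (a - b) := fun a b => by funext i; simp [hD, mul_sub]
  have hEsub : ∀ a b, E a - E b = E (a - b) := fun a b => by funext i; simp [hE, mul_sub]
  -- D maps A_P onto A_{P_λ}
  set AP : Set (Fin 5 → K) := {a | eval a (fW : MvPolynomial (Fin 5) K) = 0} ∩ ball v ![0, 0, 1, 1, 0] 1 with hAP
  set AL : Set (Fin 5 → K) := {a | eval a (fW : MvPolynomial (Fin 5) K) = 0} ∩ ball v ![0, 0, lam ^ 20, lam ^ 24, 0] 1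
    with hAL
  have hDX : ∀ a : Fin 5 → K, eval (D a) (fW : MvPolynomial (Fin 5) K) = lam ^ 198 * eval a fW := fun a => by
    rw [hD, hd]; exact eval_fW_torus lam a
  have hDmem : ∀ a ∈ AP, D a ∈ AL := by
    rintro a ⟨haX, haB⟩
    refine ⟨by rw [Set.mem_setOf_eq, hDX, haX, mul_zero], ?_⟩
    rw [mem_ball_iff, ← hDP, hDsub, hD, vnorm_mul_of_units v hdv]; exact haB
  have hEmem : ∀ a ∈ AL, E a ∈ AP := by
    rintro a ⟨haX, haB⟩
    have hX : eval (E a) (fW : MvPolynomial (Fin 5) K) = 0 := by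
      have := hDX (E a)
      rw [hDE, haX] at this
      exact (mul_eq_zero.1 this.symm).resolve_left (pow_ne_zero _ hlam0)
    refine ⟨hX, ?_⟩
    rw [mem_ball_iff, ← hED ![0, 0, 1, 1, 0], hDP, hEsub, hE, vnorm_mul_of_units v hev]; exact haB
  -- the conjugated straightener at P
  set ψ : (Fin 5 → K) → (Fin 5 → K) := fun a => E (φ (D a)) with hψ
  have hrv : ∀ a ∈ AP, ∀ b ∈ AP, RvEq v (ψ a - ψ b) (a - b) := by
    intro a ha b hb
    have h1 := hφ.rvEq (hDmem a ha) (hDmem b hb)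
    rw [hDsub] at h1
    rw [hψ]; dsimp only; rw [hEsub]
    have h2 : RvEq v (E (φ (D a) - φ (D b))) (E (D (a - b))) := by
      rw [hE]; exact (rvEq_mul_of_units_iff v hev _ _).2 h1
    rwa [hED] at h2
  have hψ_riso : IsRisometry v AP (ψ '' AP) ψ := isRisometry_image_of_rvEq hrv
  have hψ_img : ψ '' AP = E '' C := by
    ext c
    constructor
    · rintro ⟨a, ha, rfl⟩
      exact ⟨φ (D a), hφ.bijOn.mapsTo (hDmem a ha), rfl⟩
    · rintro ⟨c', hc', rfl⟩
      rw [← hφ.image_eq] at hc'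
      obtain ⟨a', ha', rfl⟩ := hc'
      refine ⟨E a', hEmem a' ha', ?_⟩
      rw [hψ]; dsimp only; rw [hDE]
  rw [hψ_img] at hψ_riso
  have hw' : vnorm v (E w) = 1 := by rw [hE, vnorm_mul_of_units v hev]; exact hw
  refine wq_no_translation_invariant_straightening v hK hw' hψ_riso fun c hc s hs => ?_
  obtain ⟨c', hc', rfl⟩ := hc
  refine ⟨c' + s • w, hT c' hc' s hs, ?_⟩
  funext i; simp [hE, mul_add, mul_left_comm]

/-- **No non-zero `κ`-subspace is a riso-triviality direction at `P_λ = (0,0,λ²⁰,λ²⁴,0)`** (`v(λ) = 1`). (derived here)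
[cite: Monreal2026, Def. 3.17] -/
theorem wq_not_isRisoTrivialOn_torus (hK : ∃ t : K, 0 < v t ∧ v t < 1) {lam : K} (hlam : v lam = 1)
    (κ : Type*) [Field κ] [Algebra κ K] {W : Submodule κ (Fin 5 → κ)} (hW : W ≠ ⊥) :
    ¬ IsRisoTrivialOn v κ {a : Fin 5 → K | eval a (fW : MvPolynomial (Fin 5) K) = 0} ![0, 0, lam ^ 20, lam ^ 24, 0] 1 W := by
  rintro ⟨φ, C, hC, hφ, hTI⟩
  obtain ⟨wb, hwbW, hwb0⟩ := Submodule.exists_mem_ne_zero_of_ne_bot hW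
  set w₁ : Fin 5 → K := fun i => algebraMap κ K (wb i) with hw₁
  have hw₁0 : 0 < vnorm v w₁ := by
    obtain ⟨i, hi⟩ : ∃ i, wb i ≠ 0 := by
      by_contra h
      simp only [not_exists, not_not] at h
      exact hwb0 (funext h)
    have : 0 < v (w₁ i) := by
      refine lt_of_le_of_ne zero_le (Ne.symm ((Valuation.ne_zero_iff v).2 ?_))
      rw [hw₁]; exact (map_ne_zero (algebraMap κ K)).2 hi
    exact lt_of_lt_of_le this (le_vnorm v w₁ i)
  obtain ⟨i₀, hi₀⟩ := exists_vnorm_eq v w₁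
  set c : K := w₁ i₀ with hc
  have hc0 : c ≠ 0 := (Valuation.ne_zero_iff v).1 (by rw [← hi₀]; exact hw₁0.ne')
  set w : Fin 5 → K := c⁻¹ • w₁ with hwdef
  have hw : vnorm v w = 1 := by
    rw [hwdef, vnorm_smul, map_inv₀, ← hi₀, inv_mul_cancel₀ hw₁0.ne']
  refine wq_no_translation_invariant_straightening_torus v hK hlam hw hφ fun c' hc' s hs => ?_
  have hsw : s • w = (s * c⁻¹) • w₁ := by rw [hwdef, smul_smul]
  have hmem : (s * c⁻¹) • w₁ ∈ subspaceBall v κ W 1 := by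
    refine smul_mem_subspaceBall hwbW (s * c⁻¹) ?_
    rw [← hsw, vnorm_smul, hw, mul_one]; exact hs
  have := hTI.add_mem ⟨hc', hC hc'⟩ hmem
  rw [← hsw] at this
  exact this.1

/-- **`rtd = 0` at every torus translate `P_λ = Γ₂(λ⁴)` of `P`**, `v(λ) = 1`. (derived here) [cite: Monreal2026, Def. 3.17] -/
theorem wq_rtd_torus_eq_zero (hK : ∃ t : K, 0 < v t ∧ v t < 1) {lam : K} (hlam : v lam = 1)
    (κ : Type*) [Field κ] [Algebra κ K] :
    rtd v κ {a : Fin 5 → K | eval a (fW : MvPolynomial (Fin 5) K) = 0} ![0, 0, lam ^ 20, lam ^ 24, 0] 1 = 0 :=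
  rtd_eq_zero_of fun _ hW => wq_not_isRisoTrivialOn_torus v hK hlam κ hW

/-- In a perfect field of characteristic `2` every element is a fourth power; a unit `μ` (`v(μ) = 1`) is `λ⁴` with `v(λ) = 1`,
and then `Γ₂(μ) = (0,0,μ⁵,μ⁶,0) = (0,0,λ²⁰,λ²⁴,0) = P_λ`. [folklore] -/
private theorem exists_fourth_root (μ : K) (hμ : v μ = 1) : ∃ lam : K, v lam = 1 ∧ lam ^ 20 = μ ^ 5 ∧ lam ^ 24 = μ ^ 6 := by
  haveI : Fact (Nat.Prime 2) := ⟨Nat.prime_two⟩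
  set l1 := (frobeniusEquiv K 2).symm μ with hl1
  set lam := (frobeniusEquiv K 2).symm l1 with hlam
  have h1 : l1 ^ 2 = μ := by
    rw [hl1]; exact (frobenius_def (p := 2) _).symm.trans ((frobeniusEquiv K 2).apply_symm_apply _)
  have h2 : lam ^ 2 = l1 := by
    rw [hlam]; exact (frobenius_def (p := 2) _).symm.trans ((frobeniusEquiv K 2).apply_symm_apply _)
  have h4 : lam ^ 4 = μ := by rw [show (4 : ℕ) = 2 * 2 by norm_num, pow_mul, h2, h1]
  refine ⟨lam, ?_, by rw [show (20 : ℕ) = 4 * 5 by norm_num, pow_mul, h4],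
    by rw [show (24 : ℕ) = 4 * 6 by norm_num, pow_mul, h4]⟩
  have : v lam ^ 4 = 1 := by rw [← map_pow, h4, hμ]
  exact (pow_eq_one_iff.1 this).resolve_right (by norm_num)

/-- **`rtd = 0` at every point `Γ₂(μ) = (0,0,μ⁵,μ⁶,0)` of the orbit with unit parameter** (`v(μ) = 1`), every coefficient
field. (derived here) [cite: Monreal2026, Def. 3.17] -/
theorem wq_rtd_gamma2_unit_eq_zero (hK : ∃ t : K, 0 < v t ∧ v t < 1) {μ : K} (hμ : v μ = 1)
    (κ : Type*) [Field κ] [Algebra κ K] :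
    (∀ W : Submodule κ (Fin 5 → κ), W ≠ ⊥ →
      ¬ IsRisoTrivialOn v κ {a : Fin 5 → K | eval a (fW : MvPolynomial (Fin 5) K) = 0} ![0, 0, μ ^ 5, μ ^ 6, 0] 1 W) ∧
    rtd v κ {a : Fin 5 → K | eval a (fW : MvPolynomial (Fin 5) K) = 0} ![0, 0, μ ^ 5, μ ^ 6, 0] 1 = 0 := by
  obtain ⟨lam, hlam, h20, h24⟩ := exists_fourth_root v μ hμ
  rw [← h20, ← h24]
  exact ⟨fun _ hW => wq_not_isRisoTrivialOn_torus v hK hlam κ hW, wq_rtd_torus_eq_zero v hK hlam κ⟩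

/-- **`rtd = 0` at EVERY arc-point of the orbit closure `Γ̄₂ = {(0,0,μ⁵,μ⁶,0)}`, `v(μ) ≤ 1`.** Unit parameters are torus
translates of `P` (`wq_rtd_gamma2_unit_eq_zero`); parameters in `𝔪` give points based at the origin, whose ball IS `B_0`
(`Monreal2026_risoBlindAlongInseparableOrbit_rtdBoth`, origin half). (derived here) [cite: Monreal2026, Def. 3.17] -/
theorem wq_rtd_gamma2_eq_zero (hK : ∃ t : K, 0 < v t ∧ v t < 1) {μ : K} (hμ : v μ ≤ 1)
    (κ : Type*) [Field κ] [Algebra κ K] :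
    (∀ W : Submodule κ (Fin 5 → κ), W ≠ ⊥ →
      ¬ IsRisoTrivialOn v κ {a : Fin 5 → K | eval a (fW : MvPolynomial (Fin 5) K) = 0} ![0, 0, μ ^ 5, μ ^ 6, 0] 1 W) ∧
    rtd v κ {a : Fin 5 → K | eval a (fW : MvPolynomial (Fin 5) K) = 0} ![0, 0, μ ^ 5, μ ^ 6, 0] 1 = 0 := by
  rcases hμ.lt_or_eq with hlt | heq
  · -- based at the origin
    have hc : vnorm v ((![0, 0, μ ^ 5, μ ^ 6, 0] : Fin 5 → K) - 0) < 1 := by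
      rw [sub_zero, vnorm_lt_iff v zero_lt_one]
      intro i; fin_cases i <;> simp <;> exact pow_lt_one₀ zero_le hlt (by norm_num)
    have hW : ∀ W : Submodule κ (Fin 5 → κ), W ≠ ⊥ →
        ¬ IsRisoTrivialOn v κ {a : Fin 5 → K | eval a (fW : MvPolynomial (Fin 5) K) = 0} ![0, 0, μ ^ 5, μ ^ 6, 0] 1 W :=
      fun W hW h => wq_not_isRisoTrivialOn_origin v hK κ hW ((isRisoTrivialOn_congr_centre v hc κ _ W).1 h)
    exact ⟨hW, rtd_eq_zero_of hW⟩
  · exact wq_rtd_gamma2_unit_eq_zero v hK heq κ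

end CharTwo

end RisoBlind

open RisoBlind Literature.AlgebraicGeometry.Resolution.Riso Literature.AlgebraicGeometry.Hironaka2017.WQWitness in
/-- **Barrier «RisoBlindAlongInseparableOrbit» — `rtd ≡ 0` along the whole orbit closure `Γ̄₂` (v3 of the kernel upgrade).**
For EVERY perfect field `K` of characteristic `2`, EVERY non-trivial valuation `v` on `K`, EVERY coefficient field `κ → K` and
EVERY integral parameter `μ` (`v(μ) ≤ 1`): at the arc-point `Γ₂(μ) = (0,0,μ⁵,μ⁶,0)` of the purely inseparable torus orbit of
the W-Q fourfold `X₂ = V(fW)`, no non-zero `κ`-subspace is a riso-triviality direction of the arc ball and `rtd = 0`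
(Monreal Def. 3.17, `Riso.rtd`). Together with `Monreal2026_risoBlindAlongInseparableOrbit_rtdBoth` (origin and `P`): the
first-shadow datum `rtd` is `0` at the `Inv`-maximal point `0` of the cell's account AND at every point of `Γ̄₂`, so the lowest
rtd-cut of `Sing X₂` contains the whole cuspidal curve `Γ̄₂ = {x=y=v=0, w⁵ = z⁶}` — the barrier's clause (ii) («not a regular
centre») and clause (i) («does not separate `0` from `P`») are now BOTH kernel statements about Monreal's definitions
(previously: cell hand computation + «by the torus»). Mechanism of the transport: the torus `λ·(x,y,z,w,v) =
(λ⁹⁹x, λ¹⁸y, λ²⁰z, λ²⁴w, λ²⁹v)` with `v(λ) = 1` is NOT a risometry (it rescales directions) but preserves the rv-RELATION of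
pairs and the valuative size, maps `X₂(K) ∩ B_P` onto `X₂(K) ∩ B_{λ·P}`, and conjugates straighteners; in a perfect field of
characteristic `2` every unit `μ` is `λ⁴`, and `λ·P = Γ₂(λ⁴)`; parameters `μ ∈ 𝔪` give points based at the origin. HONEST
FRAMING as in the companion theorems: nothing here bears on the characteristic-0 theory, on Question 1.6 in general, on
resolution of singularities in characteristic `p`, or on H. Hironaka's 2017 manuscript (under adjudication, D-0012); the
cell's `Inv`-values quoted in the barrier entry remain the cell's computation with the manuscript's invariant AS TYPED.
(derived here) [cite: Monreal2026, Def. 3.15, Def. 3.17 and Def. 4.7] -/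
theorem Monreal2026_risoBlindAlongInseparableOrbit_rtdGamma2 :
    ∀ (K : Type*) [Field K] [CharP K 2] [PerfectRing K 2] (Γ₀ : Type*) [LinearOrderedCommGroupWithZero Γ₀]
      (v : Valuation K Γ₀), (∃ t : K, 0 < v t ∧ v t < 1) →
      ∀ (κ : Type*) [Field κ] [Algebra κ K] (μ : K), v μ ≤ 1 →
        (∀ W : Submodule κ (Fin 5 → κ), W ≠ ⊥ →
          ¬ IsRisoTrivialOn v κ {a : Fin 5 → K | MvPolynomial.eval a (fW : MvPolynomial (Fin 5) K) = 0}
            ![0, 0, μ ^ 5, μ ^ 6, 0] 1 W) ∧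
        rtd v κ {a : Fin 5 → K | MvPolynomial.eval a (fW : MvPolynomial (Fin 5) K) = 0} ![0, 0, μ ^ 5, μ ^ 6, 0] 1 = 0 :=
  fun _ _ _ _ _ _ v hK κ _ _ _ hμ => wq_rtd_gamma2_eq_zero v hK hμ κ

end Literature.Barriers.ResolutionOfSingularities
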